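import Mathlib.Analysis.SpecialFunctions.Pow.Real
import HarnessLib

/-!
# Fibre counting for cross-layer contacts (helper for the refined word-uniform surface rung toward
# `StackingLiminf`, stmt-Ventures-19145)

Cell `crystal3d-full`, venture `Summits/Ventures/Crystal3D`.  Abstract counting used by
`StickyWulffConstantStackingLiminfRefinedProfile.lean`: a finite set `Q` of ordered pairs
(base, partner) in which the partner's label differs from the base's label by an offset from a
three-element set `O`, and partners of a base are told apart by their labels, has
`#Q ≤ ∑_{bases u} deg(u)` with `deg(u) = #{o ∈ O : label(u) + o ∈ T}` (`T` ⊇ partner labels);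
and `deg(u) ≤ 2` unless all three offsets are present (`deg(u) ≤ 2 + [u supported]`).

WHAT THIS IS NOT: anything about packings; pure finite counting.
-/

namespace Summit.Ventures.Crystal3D.Theorems

open Finset

/-- `#Q ≤ ∑_{u ∈ bases} #{o ∈ O : lab u + o ∈ T}` when every pair `p ∈ Q` has
`lab p.2 − lab p.1 ∈ O`, `lab p.2 ∈ T`, and pairs with the same base and the same partner label
coincide. -/
theorem card_le_sum_card_filter_offsets {ι : Type*} [DecidableEq ι] (Q : Finset (ι × ι))
    (lab : ι → ℤ × ℤ) (O T : Finset (ℤ × ℤ))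
    (hO : ∀ p ∈ Q, lab p.2 - lab p.1 ∈ O) (hT : ∀ p ∈ Q, lab p.2 ∈ T)
    (hinj : ∀ p ∈ Q, ∀ p' ∈ Q, p.1 = p'.1 → lab p.2 = lab p'.2 → p = p') :
    Q.card ≤ ∑ u ∈ Q.image Prod.fst, (O.filter fun o => lab u + o ∈ T).card := by
  rw [card_eq_sum_card_fiberwise (f := Prod.fst) (s := Q) (t := Q.image Prod.fst)
    fun p hp => mem_image_of_mem _ hp]
  refine sum_le_sum fun u _ => ?_
  refine card_le_card_of_injOn (fun p => lab p.2 - lab u) (fun p hp => ?_) ?_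
  · obtain ⟨hpQ, hpu⟩ := mem_filter.1 (mem_coe.1 hp)
    rw [mem_coe, mem_filter]
    refine ⟨hpu ▸ hO p hpQ, ?_⟩
    rw [add_sub_cancel]
    exact hT p hpQ
  · intro p hp p' hp' heq
    obtain ⟨hpQ, hpu⟩ := mem_filter.1 (mem_coe.1 hp)
    obtain ⟨hpQ', hpu'⟩ := mem_filter.1 (mem_coe.1 hp')
    have hl : lab p.2 = lab p'.2 := sub_left_injective heq
    exact hinj p hpQ p' hpQ' (hpu.trans hpu'.symm) hl

/-- A three-element offset set filtered by a predicate has at most `2 + [all three pass]`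
elements. -/
theorem card_filter_le_two_add {O : Finset (ℤ × ℤ)} (hO : O.card = 3) (P : ℤ × ℤ → Prop)
    [DecidablePred P] :
    (O.filter P).card ≤ 2 + (if ∀ o ∈ O, P o then 1 else 0) := by
  split_ifs with h
  · calc (O.filter P).card ≤ O.card := card_filter_le _ _
      _ = 2 + 1 := by rw [hO]
  · push Not at h
    obtain ⟨o, hoO, hPo⟩ := h
    have hsub : O.filter P ⊆ O.erase o := fun o' ho' => by
      obtain ⟨ho'O, hPo'⟩ := mem_filter.1 ho'
      exact mem_erase.2 ⟨fun h => hPo (h ▸ hPo'), ho'O⟩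
    calc (O.filter P).card ≤ (O.erase o).card := card_le_card hsub
      _ = 2 + 0 := by rw [card_erase_of_mem hoO, hO]

/-- Summing the degree bound over the bases: `∑_{u ∈ B} #{o ∈ O : P u o} ≤ 2#B + #{u ∈ B : all
three}`. -/
theorem sum_card_filter_le {ι : Type*} (B : Finset ι) {O : Finset (ℤ × ℤ)} (hO : O.card = 3)
    (P : ι → ℤ × ℤ → Prop) [∀ u, DecidablePred (P u)] :
    ∑ u ∈ B, (O.filter (P u)).card ≤ 2 * B.card + (B.filter fun u => ∀ o ∈ O, P u o).card := by
  calc ∑ u ∈ B, (O.filter (P u)).card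
      ≤ ∑ u ∈ B, (2 + (if ∀ o ∈ O, P u o then 1 else 0)) :=
        sum_le_sum fun u _ => card_filter_le_two_add hO (P u)
    _ = 2 * B.card + (B.filter fun u => ∀ o ∈ O, P u o).card := by
        rw [sum_add_distrib, sum_const, smul_eq_mul, mul_comm, sum_boole, Nat.cast_id]

end Summit.Ventures.Crystal3D.Theorems
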